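import Summits.BirchSwinnertonDyer.Rank1Residual.X4.KuriharaLevelLoweringModPow
import HarnessLib

/-!
# Level lowering kills Kurihara numbers modulo `p^e` at SEVERAL defect primes at once: the MULTI-PRIME certificate (`PlusSymbolLevelLowersModAtOn W p f (p^e) S`) — a SUM of `ℓ`-old differences over a finite set `S` of primes — forces `δ̃_n^{(k)} = 0` for every `k ≤ e`, `n ∈ 𝒩_k`, hence `∂^{(∞)}(δ̃) ≥ e`; MEASURED: with eigen components `e ≤ max_ℓ ord_p c_ℓ` (cell `b2b-bsdres`, seat additive-p4 gen 30, line V51; CLASS-CLOSURE §3.1 N11 / §3.2 N10)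

HONEST FRAMING (verbatim, cell `b2b-bsdres`): the goal of the cell is to DELETE the COMBINATION-SHAPED
residual classes for ALL analytic-rank `≤ 1` curves over `ℚ` — "full BSD formula for every rank `≤ 1`
curve in class `C`" assembled STRICTLY from published theorems — so that the rank-`≤ 1` remainder
becomes exactly the CONSTRUCTION-SHAPED classes, which are TYPED (missing-input Props), NOT attempted;
this is not "finishing BSD". This file: a research-route KERNEL THEOREM (pure algebra over the tree's
`kuriharaNumber`; no named fact, no conjecture, nothing booked; X4 stays CONSTRUCTION-SHAPED; no
Literature fact is minted; labels unchanged).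

## What is proved

Gen 29 (`X4/KuriharaLevelLoweringModPow.lean`) attached to ONE defect prime `ℓ` the finite certificate
`PlusSymbolLevelLowersModAt W p f (p^e) ℓ` — `\overline{[r]⁺_f} = μ(r) − μ(ℓ r)` in `ℤ/p^e` with `μ`
periodic and `T_q`-eigen at the Kolyvagin primes — and proved `∂^{(∞)}(δ̃) ≥ e`; the ONE-FACTOR socket
then closes the unit rows with `ord_p ∏ c ≤ e + 1`, so a row is closable when its Tamagawa defect sits
at ONE prime up to one unit of slack (gen 29 E2 anatomy at `p = 3`: 208 of the 235 `ord₃ ∏ c ≥ 3`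
unit rows). The 27 SPREAD rows — two or more Tamagawa primes beyond the slack — had "no symbol-side
finite certificate". The descent identity `kuriharaSum_oldform_eq_zero` is LINEAR and needs of `μ`
only periodicity, the Hecke relation at the primes of `n`, and `ℓ` prime to `n` (no level condition):
so a SUM of `ℓ`-old differences over any finite set `S` of primes prime to `n` has vanishing Kurihara
sums too. This file records that:

* `kuriharaSum_oldformSum_eq_zero` — the ring-general identity for `∑_{ℓ ∈ S} (μ_ℓ(r) − μ_ℓ(ℓ r))`.
* `PlusSymbolLevelLowersModAtOn W p f m S` — the MULTI-PRIME CERTIFICATE at the modulus `m`: periodic,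
  `T_q`-eigen (`a_q(E) mod m` at every `q ∈ 𝒫_1(E, p)`) functions `μ_ℓ : ℚ → ℤ/m` (`ℓ ∈ S`) with
  `\overline{[r]⁺_f} = ∑_{ℓ ∈ S} (μ_ℓ(r) − μ_ℓ(ℓ·r))` for every `r`. At `S = {ℓ}` it IS gen 29's
  certificate (`plusSymbolLevelLowersModAtOn_singleton_iff`); it is monotone in `S`
  (`PlusSymbolLevelLowersModAtOn.mono`). The filtered form one would write first —
  `[·]⁺_f = x_{ℓ₁} + p·x_{ℓ₂} + p²·(…)` with `x_ℓ` an `ℓ`-old difference — is the same predicate, each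
  old difference being a `ℤ/m`-submodule.
* `kuriharaNumber_eq_zero_of_plusSymbolLevelLowersModAtOn` — the certificate at `m = p^e` on a set `S`
  of divisors of `N_E`, `k ≤ e`, `n ∈ 𝒩_k(E, p)`, `p`-integral symbols ⟹ `kuriharaNumber f (p^k) n ψ
  = 0` for EVERY `ψ` (reduce the witnesses along `ℤ/p^e → ℤ/p^k` as in gen 29 and sum the per-prime
  identities).
* `kuriharaDivisibleAt_of_…On`, **`le_kuriharaPartialInfty_of_plusSymbolLevelLowersModAtOn`**
  (`∂^{(∞)}(δ̃) ≥ e`), `pow_min_dvd_kuriharaNumber_of_…On`, `kuriharaNumber_eq_zero_of_…On_of_le` —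
  for the newform of an elliptic curve with `E[p]` irreducible, `p` odd, conductor `= N`.

Consumers: none of record. The same sockets as gen 29 (`α = e`) would take the JOINT exponent of a
set of defect primes, but see the next section: with `T_q`-EIGEN components the joint exponent never
exceeds the best single-prime exponent, so this predicate is the eigen-component SOCKET only; the
additivity that would reach the SPREAD rows lives in NON-eigen components and is handled by
`X4/KuriharaLevelLoweringDescentDefect.lean` (descent with a Hecke defect) and
`X4/KuriharaAdditiveLevelLowering.lean` (the two-prime theorem from a `τ`-system).

## Where the certificate comes from, and what the instrument MEASURED (gen 30, E8; EVIDENCE per row)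

For `f = f_E`, `E[p]` irreducible and split multiplicative primes `ℓ ∈ S` with `p^{e_ℓ} ∥ c_ℓ`, each
single certificate holds exactly up to `e_ℓ` (gen 29 E7: `EMAX = ord_p c_ℓ` on 74/74 pairs). The
pre-registered prediction that the eigen-component JOINT certificate reaches `e = ∑_{ℓ∈S} e_ℓ` (the
symbol-side shadow of Kim's Conjecture 1.10, `∂^{(∞)} = ∑_ℓ ord_p c_ℓ`) is REFUTED: on every decided
row of the seat's validation set (V43 rows with two split defect primes, `N < 30 000`; 19/19 at the
time of writing, exponent shapes `(1,1)`, `(2,1)`, `(3,1)`) the eigen-component joint exponent is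
`max_ℓ e_ℓ`, never `∑`. Reason: a `T_q`-eigen `μ_ℓ` with `f`'s eigenvalues mod `p^k` that is
non-zero mod `p` exists in level `N/ℓ` iff `k ≤ e_ℓ`, so for `k > e_ℓ` every admissible `μ_ℓ` is
`≡ 0 (mod p^{k−e_ℓ})` and `∑_ℓ (μ_ℓ − μ_ℓ∘[ℓ]) ≡ 0 (mod p^{k − max e_ℓ})` cannot equal `f ≢ 0 (mod p)`.
By contrast the COMPONENT-FREE joint decomposition (`μ_ℓ` arbitrary in the saturated lattice of
level `N/ℓ`; Pollack–Weston's "quantitative level lowering" quantity, Kim–Ota Conj. 1.1 / Thm. 1.3)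
is measured at EXACTLY `∑_ℓ e_ℓ` (solvable at `∑`, not at `∑ + 1`) — the additivity is real but the
summands are not Hecke eigenvectors (a non-trivial class in `Ext¹` over the Hecke algebra), which is
why this file's vanishing theorem does not apply to it; the sibling files above supply the mechanism.
A per-pair FINITE certificate in all cases (cell instrument E8 `llcertmulti.gp`), never a Literature
fact. Nothing here depends on it.

## References

* B. Mazur, J. Tate, J. Teitelbaum, Invent. Math. 84 (1986), §I.4 (4.2). [cite: MazurTateTeitelbaum1986Invent, §I.4 (4.2)]
* M. Kurihara, Contrib. Math. Comput. Sci. 7 (2014) 317–356, §1.1 (1)–(2). [cite: Kurihara2014, §1.1]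
* C.-H. Kim, Amer. J. Math. 148 (2026), §1.4.3, §1.5.1, Thm. 1.9 (6), Conj. 1.10, Rem. 6.2. [cite: Kim2022StructureSelmer, §1.5.1, Conj. 1.10 and Rem. 6.2 (PDF pp. 7–8, 31)]
* B. Mazur, K. Rubin, Mem. AMS 799 (2004), Prop. 6.2.6 (non-primitivity prime by prime). [cite: MazurRubin2004, Prop. 6.2.6]
* R. Pollack, T. Weston, Compos. Math. 147 (2011) 1353–1381 (quantitative level lowering; the
  component-free additivity; not an input here). [cite: PollackWeston2011, Thm. 1.2 (via Kim–Ota Conj. 1.1)]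
* C.-H. Kim, K. Ota, arXiv:1905.02926, Conj. 1.1 and Thm. 1.3 (additivity of Tamagawa exponents in
  congruence ideals; not an input here). [cite: KimOta2019CongruenceIdeals, Conj. 1.1 and Thm. 1.3 (p. 3)]
-/

noncomputable section

open scoped MatrixGroups ModularForm

open CongruenceSubgroup Finset

open Literature.NumberTheory.EllipticCurves Literature.NumberTheory.EllipticCurves.ModularForms

open Literature.NumberTheory.DiophantineGeometry.Dioph (ratModP)

namespace Summit.BirchSwinnertonDyer.Rank1Residual.LevelLowering

variable {R : Type*}

/-! ### §1 The ring-general descent identity for a SUM of `ℓ`-old differences -/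

section Descent

variable [CommRing R] (ψ : (q : ℕ) → (ZMod q)ˣ →* Multiplicative R)

/-- **Level lowering at SEVERAL primes kills Kurihara sums.** `μ_ℓ : ℚ → R` (`ℓ ∈ S`) periodic with
the Hecke relation (eigenvalue `2`) at every prime of the square-free `n`, every `ℓ ∈ S` prime to `n`.
Then the Kurihara sum at `n` of the SUM of `ℓ`-old differences `λ(r) = ∑_{ℓ ∈ S} (μ_ℓ(r) − μ_ℓ(ℓ r))`
vanishes: `∑_{a ∈ (ℤ/n)ˣ} λ(a/n) · ∏_{q ∣ n} ψ_q(a) = 0` (linearity over gen 20's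
`kuriharaSum_oldform_eq_zero`). [cite: Kurihara2014, §1.1 (1)–(2)] [cite: MazurTateTeitelbaum1986Invent, §I.4 (4.2)] -/
theorem kuriharaSum_oldformSum_eq_zero (S : Finset ℕ) {μ : ℕ → ℚ → R}
    (hμ : ∀ ℓ ∈ S, IsPeriodic (μ ℓ)) {P : ℕ → Prop}
    (hP : ∀ ℓ ∈ S, ∀ q, P q → q.Prime ∧ HeckeRel (μ ℓ) q 2) (n : ℕ) [NeZero n] (hn : Squarefree n)
    (hPn : ∀ q ∈ n.primeFactors, P q) (hS : ∀ ℓ ∈ S, ℓ.Coprime n) :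
    ∑ a : (ZMod n)ˣ, (∑ ℓ ∈ S, (μ ℓ ((((a : ZMod n).val : ℕ) : ℚ) / n) -
        μ ℓ ((ℓ : ℚ) * ((((a : ZMod n).val : ℕ) : ℚ) / n)))) * weight ψ n n.primeFactors a = 0 := by
  simp_rw [Finset.sum_mul]
  rw [Finset.sum_comm]
  exact Finset.sum_eq_zero fun ℓ hℓ ↦
    kuriharaSum_oldform_eq_zero ψ (hμ ℓ hℓ) (hP ℓ hℓ) n hn hPn (hS ℓ hℓ)

end Descent

/-! ### §2 The multi-prime certificate at a modulus `m` and the vanishing of the mod-`p^k` Kurihara numbers -/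

section ModPow

variable (W : WeierstrassCurve ℚ) [W.IsGloballyMinimal] (p : ℕ) {N : ℕ} (f : CuspForm (Gamma0 N) 2)

/-- **MULTI-PRIME LEVEL-LOWERING CERTIFICATE for the plus symbol of `f` on the finite set `S` of primes,
MODULO `m`** (a FINITE object: the modular-symbol lattices of levels `N` and `N/ℓ`, `ℓ ∈ S`, reduced
mod `m`), in the currency of the tree's `kuriharaNumber` (`\overline{q} = ratModP m q`): there are
`1`-periodic `μ_ℓ : ℚ → ℤ/m` (`ℓ ∈ S`), each `T_q`-eigen with eigenvalue `a_q(E) mod m` at every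
Kolyvagin prime `q ∈ 𝒫_1(E, p)` (`q ∤ Np`, `q ≡ 1`, `a_q ≡ q + 1 (mod p)`; Kim §1.2.2), whose SUM of
`ℓ`-old differences is the reduced plus symbol of `f`:
`\overline{[r]⁺_f} = ∑_{ℓ ∈ S} (μ_ℓ(r) − μ_ℓ(ℓ·r))` for every `r ∈ ℚ`. At `S = {ℓ}` this is gen 29's
`PlusSymbolLevelLowersModAt W p f m ℓ` (`plusSymbolLevelLowersModAtOn_singleton_iff`). MEASURED (cell
instrument E8, gen 30; EVIDENCE): with eigen components the largest `m = p^k` for which this holds is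
`p^{max_ℓ ord_p c_ℓ}` — the predicate is NOT available at the joint exponent `∑_ℓ ord_p c_ℓ` (the
component-free decomposition is; see the module docstring). A predicate; nothing asserted.
[cite: Kim2022StructureSelmer, §1.2.2, §1.4.3 and Conj. 1.10 (PDF pp. 5, 7, 8)]
[cite: MazurRubin2004, Prop. 6.2.6] [cite: MazurTateTeitelbaum1986Invent, §I.4 (4.2)] -/
def PlusSymbolLevelLowersModAtOn (m : ℕ) (S : Finset ℕ) : Prop :=
  ∃ μ : ℕ → ℚ → ZMod m, (∀ ℓ ∈ S, IsPeriodic (μ ℓ)) ∧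
    (∀ ℓ ∈ S, ∀ q : ℕ, Kato.IsKolyvaginPrime W p 1 q → HeckeRel (μ ℓ) q (W.frobeniusTrace q : ZMod m)) ∧
    ∀ r : ℚ, ratModP m (ratPlusSymbol f r) = ∑ ℓ ∈ S, (μ ℓ r - μ ℓ (ℓ * r))

variable {W p f}

/-- **At `S = {ℓ}` the multi-prime certificate IS gen 29's single-prime certificate**
`PlusSymbolLevelLowersModAt W p f m ℓ`. [cite: Kim2022StructureSelmer, §1.4.3 (PDF p. 7)] -/
theorem plusSymbolLevelLowersModAtOn_singleton_iff {m ℓ : ℕ} :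
    PlusSymbolLevelLowersModAtOn W p f m {ℓ} ↔ PlusSymbolLevelLowersModAt W p f m ℓ := by
  constructor
  · rintro ⟨μ, hμ, hH, hsym⟩
    refine ⟨μ ℓ, hμ ℓ (Finset.mem_singleton_self ℓ), hH ℓ (Finset.mem_singleton_self ℓ), fun r ↦ ?_⟩
    rw [hsym r, Finset.sum_singleton]
  · rintro ⟨μ, hμ, hH, hsym⟩
    refine ⟨fun _ ↦ μ, fun _ _ ↦ hμ, fun _ _ ↦ hH, fun r ↦ ?_⟩
    rw [hsym r, Finset.sum_singleton]

/-- **The multi-prime certificate is MONOTONE in the set of primes**: a certificate on `S` is one on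
any `T ⊇ S` (extend the witnesses by `0`, which is periodic and `T_q`-eigen). [folklore] -/
theorem PlusSymbolLevelLowersModAtOn.mono {m : ℕ} {S T : Finset ℕ} (hST : S ⊆ T)
    (h : PlusSymbolLevelLowersModAtOn W p f m S) : PlusSymbolLevelLowersModAtOn W p f m T := by
  classical
  obtain ⟨μ, hμ, hH, hsym⟩ := h
  refine ⟨fun ℓ ↦ if ℓ ∈ S then μ ℓ else 0, fun ℓ _ ↦ ?_, fun ℓ _ q hq ↦ ?_, fun r ↦ ?_⟩
  · by_cases hℓ : ℓ ∈ S
    · simp only [hℓ, if_true]; exact hμ ℓ hℓ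
    · simp only [hℓ, if_false]; exact fun _ _ ↦ rfl
  · by_cases hℓ : ℓ ∈ S
    · simp only [hℓ, if_true]; exact hH ℓ hℓ q hq
    · simp only [hℓ, if_false]
      intro r
      simp only [Pi.zero_apply, Finset.sum_const_zero, zero_add, mul_zero]
  · rw [hsym r, ← Finset.sum_subset hST]
    · exact Finset.sum_congr rfl fun ℓ hℓ ↦ by simp only [hℓ, if_true]
    · intro ℓ _ hℓ
      simp only [hℓ, if_false, Pi.zero_apply, sub_zero]

/-- **The single-prime certificate is a multi-prime certificate on any set containing the prime.**
[cite: Kim2022StructureSelmer, §1.4.3 (PDF p. 7)] -/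
theorem plusSymbolLevelLowersModAtOn_of_modAt {m ℓ : ℕ} {S : Finset ℕ} (hℓ : ℓ ∈ S)
    (h : PlusSymbolLevelLowersModAt W p f m ℓ) : PlusSymbolLevelLowersModAtOn W p f m S :=
  (plusSymbolLevelLowersModAtOn_singleton_iff.mpr h).mono (Finset.singleton_subset_iff.mpr hℓ)

/-- **EVERY mod-`p^k` Kurihara number vanishes under the multi-prime mod-`p^e` certificate, `k ≤ e`**:
if the plus symbol of `f` level-lowers modulo `p^e` on a finite set `S` of divisors of `N_E`
(`PlusSymbolLevelLowersModAtOn W p f (p^e) S`), `n ∈ 𝒩_k(E, p)` with `k ≤ e`, and the symbols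
`[a/n]⁺_f` (`a ∈ (ℤ/n)ˣ`) are `p`-integral, then `kuriharaNumber f (p^k) n ψ = 0` for EVERY choice of
discrete logarithms `ψ` into `ℤ/p^k`. Proof: reduce each witness `μ_ℓ` along `ℤ/p^e → ℤ/p^k` (the
Kolyvagin primes of `n` become `T_q`-eigen primes of eigenvalue `2`, and are prime to every
`ℓ ∣ N_E`), use that the reduction commutes with `ratModP` on `p`-integral rationals
(`KuriharaReduction.castHom_ratModP_pow`), and apply `kuriharaSum_oldformSum_eq_zero` over `ℤ/p^k`.
[cite: Kim2022StructureSelmer, §1.2.2 and §1.4.3 (PDF pp. 5, 7)] [cite: Kurihara2014, §1.1 (1)–(2)] -/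
theorem kuriharaNumber_eq_zero_of_plusSymbolLevelLowersModAtOn [Fact p.Prime] {e : ℕ} {S : Finset ℕ}
    (hcert : PlusSymbolLevelLowersModAtOn W p f (p ^ e) S) (hS : ∀ ℓ ∈ S, ℓ ∣ W.conductorNorm ℤ)
    {k : ℕ} (hk : k ≤ e) {n : ℕ} [NeZero n] (hn : Kato.IsKolyvaginProduct W p k n)
    (hden : ∀ a : (ZMod n)ˣ, ¬ p ∣ (ratPlusSymbol f (((a : ZMod n).val : ℚ) / n)).den)
    (ψ : (q : ℕ) → (ZMod q)ˣ →* Multiplicative (ZMod (p ^ k))) :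
    kuriharaNumber f (p ^ k) n ψ = 0 := by
  rcases Nat.eq_zero_or_pos k with rfl | hk1
  · haveI : Subsingleton (ZMod (p ^ 0)) := ZMod.subsingleton_iff.mpr (pow_zero p)
    exact Subsingleton.elim _ _
  obtain ⟨μ, hμ, hH, hsym⟩ := hcert
  set φ : ZMod (p ^ e) →+* ZMod (p ^ k) := ZMod.castHom (pow_dvd_pow p hk) (ZMod (p ^ k))
    with hφ
  have hμ' : ∀ ℓ ∈ S, IsPeriodic (φ ∘ μ ℓ) := fun ℓ hℓ ↦ (hμ ℓ hℓ).map φ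
  have hP : ∀ ℓ ∈ S, ∀ q, Kato.IsKolyvaginPrime W p k q → q.Prime ∧ HeckeRel (φ ∘ μ ℓ) q 2 :=
    fun ℓ hℓ q hq ↦
      ⟨hq.prime, heckeRel_two_castHom_comp_of_isKolyvaginPrime (pow_dvd_pow p hk) (hH ℓ hℓ) hk1 hq⟩
  have hcop : ∀ ℓ ∈ S, ℓ.Coprime n := fun ℓ hℓ ↦ Nat.coprime_of_dvd fun k hk hkℓ hkn ↦
    (hn.2 k (Nat.mem_primeFactors.mpr ⟨hk, hkn, NeZero.ne n⟩)).not_dvd_conductorNorm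
      (dvd_trans hkℓ (hS ℓ hℓ))
  have hterm : ∀ a : (ZMod n)ˣ,
      ratModP (p ^ k) (ratPlusSymbol f (((a : ZMod n).val : ℚ) / n)) =
        ∑ ℓ ∈ S, ((φ ∘ μ ℓ) ((((a : ZMod n).val : ℕ) : ℚ) / n) -
          (φ ∘ μ ℓ) ((ℓ : ℚ) * ((((a : ZMod n).val : ℕ) : ℚ) / n))) := by
    intro a
    rw [← Additive.KuriharaReduction.castHom_ratModP_pow p hk (hden a), hsym, map_sum]
    exact Finset.sum_congr rfl fun ℓ _ ↦ by rw [map_sub]; rfl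
  have hmain := kuriharaSum_oldformSum_eq_zero ψ S hμ' hP n hn.squarefree hn.2 hcop
  rw [kuriharaNumber_def]
  refine (Finset.sum_congr rfl fun a _ ↦ ?_).trans hmain
  rw [prod_attach_toAdd_eq_weight, hterm a]

/-- **The special case `k = e`**: the multi-prime mod-`p^e` certificate kills every mod-`p^e` Kurihara
number at the levels `n ∈ 𝒩_e(E, p)` with `p`-integral symbols. [cite: Kim2022StructureSelmer, §1.4.3 (PDF p. 7)] -/
theorem kuriharaNumber_eq_zero_of_plusSymbolLevelLowersModAtOn_self [Fact p.Prime] {e : ℕ}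
    {S : Finset ℕ} (hcert : PlusSymbolLevelLowersModAtOn W p f (p ^ e) S)
    (hS : ∀ ℓ ∈ S, ℓ ∣ W.conductorNorm ℤ)
    {n : ℕ} [NeZero n] (hn : Kato.IsKolyvaginProduct W p e n)
    (hden : ∀ a : (ZMod n)ˣ, ¬ p ∣ (ratPlusSymbol f (((a : ZMod n).val : ℚ) / n)).den)
    (ψ : (q : ℕ) → (ZMod q)ˣ →* Multiplicative (ZMod (p ^ e))) :
    kuriharaNumber f (p ^ e) n ψ = 0 :=
  kuriharaNumber_eq_zero_of_plusSymbolLevelLowersModAtOn hcert hS le_rfl hn hden ψ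

end ModPow

/-! ### §3 Application to the newform of an elliptic curve: `∂^{(∞)}(δ̃) ≥ e` from the joint exponent -/

section Application

variable {W : WeierstrassCurve ℚ} [W.IsElliptic] [W.IsGloballyMinimal] {p : ℕ} [Fact p.Prime]

/-- **`δ̃_n ∈ p^e ℤ_p/I_nℤ_p` at every level** (`KuriharaDivisibleAt … n e`) for the newform `D.f` of an
elliptic curve with `E[p]` irreducible, `p` odd, conductor `= N` (so that the symbols at Kolyvagin
levels are `p`-integral, `IsNewformOf.not_dvd_den_ratPlusSymbol_div`), under the multi-prime mod-`p^e`
certificate on a set `S` of divisors of `N_E`.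
[cite: Kim2022StructureSelmer, §1.4.3 and §1.5.1 (PDF p. 7), Def. 2.13 (PDF p. 14)] -/
theorem kuriharaDivisibleAt_of_plusSymbolLevelLowersModAtOn
    (hp2 : p ≠ 2) (hirr : W.HasIrreducibleModPGaloisRep p) {N : ℕ} [NeZero N]
    (D : ModularParametrizationData W N) (hN : W.conductorNorm ℤ = N) {e : ℕ} {S : Finset ℕ}
    (hcert : PlusSymbolLevelLowersModAtOn W p D.f (p ^ e) S) (hS : ∀ ℓ ∈ S, ℓ ∣ W.conductorNorm ℤ)
    (n : ℕ) : KuriharaDivisibleAt W p D.f n e := by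
  intro k hk hkn ψ _
  haveI : NeZero n := ⟨hkn.ne_zero⟩
  have hcopN : n.Coprime N := by
    have := hkn.coprime
    rw [hN] at this
    exact Nat.Coprime.coprime_dvd_right (dvd_mul_right N p) this
  have hden : ∀ a : (ZMod n)ˣ, ¬ p ∣ (ratPlusSymbol D.f (((a : ZMod n).val : ℚ) / n)).den := by
    intro a
    have hnd := D.isNewformOf.not_dvd_den_ratPlusSymbol_div hp2 hirr hcopN ((a : ZMod n).val : ℤ)
    rwa [Int.cast_natCast] at hnd
  exact kuriharaNumber_eq_zero_of_plusSymbolLevelLowersModAtOn hcert hS hk hkn hden ψ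

/-- **`∂^{(∞)}(δ̃) ≥ e` under the multi-prime mod-`p^e` certificate** (the tree's
`kuriharaPartialInfty`, cyclic levels): every divisibility index is `≥ e`. This is the input `α = e`
of the ONE-FACTOR SOCKET `X4.bsdp_of_le_kimDefect_of_tamagawa_le_add_one_of_shaAn_unit` (file
`X4/KimDefectParity.lean`): the unit rows with `ord_p ∏_v c_v ≤ e + 1` close. (Measured, gen 30: with
eigen components `e ≤ max_ℓ ord_p c_ℓ`, so this is never more than the single-prime input.)
[cite: Kim2022StructureSelmer, §1.5.1 (PDF p. 7) and Conj. 1.10 (PDF p. 8)] -/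
theorem le_kuriharaPartialInfty_of_plusSymbolLevelLowersModAtOn
    (hp2 : p ≠ 2) (hirr : W.HasIrreducibleModPGaloisRep p) {N : ℕ} [NeZero N]
    (D : ModularParametrizationData W N) (hN : W.conductorNorm ℤ = N) {e : ℕ} {S : Finset ℕ}
    (hcert : PlusSymbolLevelLowersModAtOn W p D.f (p ^ e) S) (hS : ∀ ℓ ∈ S, ℓ ∣ W.conductorNorm ℤ) :
    (e : ℕ∞) ≤ kuriharaPartialInfty W p D.f := by
  refine le_iInf fun i ↦ ?_
  rw [kuriharaPartial_def]
  refine le_iInf fun n ↦ le_iInf fun _ ↦ le_iInf fun _ ↦ ?_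
  exact le_kuriharaDivIndex_of_divisibleAt W p D.f
    (kuriharaDivisibleAt_of_plusSymbolLevelLowersModAtOn hp2 hirr D hN hcert hS n)

/-- **The E67 hypothesis at `m = e`**: `p^{min(e,k)} ∣ δ̃_n^{(k)}` for every `k`, every `n ∈ 𝒩_k` and
every surjective `ψ` — the universally quantified input of
`Kim2026.rankZero_padicValNat_sha_add_le_of_forall_pow_dvd_kuriharaNumber` (Kim Thm. 1.8 (6) read
with `∂^{(∞)} ≥ e`) — under the multi-prime mod-`p^e` certificate.
[cite: Kim2022StructureSelmer, Thm. 1.9 (6) (PDF p. 8), §1.5.1 (PDF p. 7)] -/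
theorem pow_min_dvd_kuriharaNumber_of_plusSymbolLevelLowersModAtOn
    (hp2 : p ≠ 2) (hirr : W.HasIrreducibleModPGaloisRep p) {N : ℕ} [NeZero N]
    (D : ModularParametrizationData W N) (hN : W.conductorNorm ℤ = N) {e : ℕ} {S : Finset ℕ}
    (hcert : PlusSymbolLevelLowersModAtOn W p D.f (p ^ e) S) (hS : ∀ ℓ ∈ S, ℓ ∣ W.conductorNorm ℤ)
    {k : ℕ} {n : ℕ} [NeZero n] (hn : Kato.IsKolyvaginProduct W p k n)
    (ψ : (q : ℕ) → (ZMod q)ˣ →* Multiplicative (ZMod (p ^ k)))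
    (hψ : ∀ q ∈ n.primeFactors, Function.Surjective (ψ q)) :
    ((p ^ min e k : ℕ) : ZMod (p ^ k)) ∣ kuriharaNumber D.f (p ^ k) n ψ :=
  Kim2026.pow_min_dvd_kuriharaNumber_of_kuriharaDivisibleAt W p hp2 hirr D hN hn
    (kuriharaDivisibleAt_of_plusSymbolLevelLowersModAtOn hp2 hirr D hN hcert hS n) ψ hψ

/-- **No Kurihara number of level `k ≤ e` is non-zero under the multi-prime mod-`p^e` certificate** —
the instrument-scope corollary: on a row certified modulo `p^e` on its set of defect primes, the
census's search for a unit (or merely non-zero) `δ̃_n^{(k)}` can only fire at levels `k ≥ e + 1`, i.e.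
the LOWER-half witness on a rank-one Tamagawa row is a Kurihara number modulo `p^{e+1}` with `e` the
JOINT exponent. [cite: Kim2022StructureSelmer, §1.5.1 (PDF p. 7) and Rem. 6.2 (PDF p. 31)] -/
theorem kuriharaNumber_eq_zero_of_plusSymbolLevelLowersModAtOn_of_le
    (hp2 : p ≠ 2) (hirr : W.HasIrreducibleModPGaloisRep p) {N : ℕ} [NeZero N]
    (D : ModularParametrizationData W N) (hN : W.conductorNorm ℤ = N) {e : ℕ} {S : Finset ℕ}
    (hcert : PlusSymbolLevelLowersModAtOn W p D.f (p ^ e) S) (hS : ∀ ℓ ∈ S, ℓ ∣ W.conductorNorm ℤ)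
    {k : ℕ} (hk : k ≤ e) {n : ℕ} [NeZero n] (hn : Kato.IsKolyvaginProduct W p k n)
    (ψ : (q : ℕ) → (ZMod q)ˣ →* Multiplicative (ZMod (p ^ k))) :
    kuriharaNumber D.f (p ^ k) n ψ = 0 := by
  have hcopN : n.Coprime N := by
    have := hn.coprime
    rw [hN] at this
    exact Nat.Coprime.coprime_dvd_right (dvd_mul_right N p) this
  have hden : ∀ a : (ZMod n)ˣ, ¬ p ∣ (ratPlusSymbol D.f (((a : ZMod n).val : ℚ) / n)).den := by
    intro a
    have hnd := D.isNewformOf.not_dvd_den_ratPlusSymbol_div hp2 hirr hcopN ((a : ZMod n).val : ℤ)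
    rwa [Int.cast_natCast] at hnd
  exact kuriharaNumber_eq_zero_of_plusSymbolLevelLowersModAtOn hcert hS hk hn hden ψ

end Application

end Summit.BirchSwinnertonDyer.Rank1Residual.LevelLowering

end
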